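import Summits.BirchSwinnertonDyer.BirchSwinnertonDyer.Theorems.Rank2Observatory2DescClFracElt
import Summits.BirchSwinnertonDyer.BirchSwinnertonDyer.Theorems.Rank2Observatory2DescClValuation
import Summits.BirchSwinnertonDyer.BirchSwinnertonDyer.Theorems.Rank2Observatory2DescClPrimesOver
import Summits.BirchSwinnertonDyer.BirchSwinnertonDyer.Theorems.Rank2Observatory2DescClClassGen
import HarnessLib

/-!
# BirchSwinnertonDyer — rank ≥ 2 observatory: KERNEL-2DESC-CL v3.0, S2 — NORM-NAMED PRIMES ABOVE A TOTALLY SPLIT 2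

HONEST FRAMING: per-curve certified theorems and census instruments; no claim on BSD in rank ≥ 2.

Generic layer of the KERNEL-2DESC-CL instrument (design `…/v2/generics/v27/noeta/SPLIT2-SPEC.md` §1, §3).
When `2 = 𝔭₀𝔭₁𝔭₂` is totally split in the cubic field `K` (a common index divisor: no monogenic order is
`2`-maximal, so Dedekind–Kummer names nothing above `2`), the three primes are NAMED BY ELEMENTS: a certificate
`SplitTwo` carries fractional one-view elements `π₀, π₁, π₂` (`…ClFracElt`) with `|N(πᵢ)| = 2·nᵢ`, `nᵢ` odd, the
product identity `π₀π₁π₂ = 2·H` (`H` integral), and the witnesses `πⱼ − 1 = 2·s + πᵢ·t` (`i ≠ j`).  Soundness: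
* `Iᵢ := (2, πᵢ)` is proper (else `2 ∣ πⱼπₖ`, contradicting `8 ∤ 4nⱼnₖ`), `absNorm Iᵢ ∣ gcd(8, 2nᵢ)` forces
  `absNorm Iᵢ = 2`: `Iᵢ` is a prime of residue degree one (`SplitTwo.w i : HeightOneSpectrum`);
* the three are pairwise distinct (`πⱼ ∈ Iⱼ`, `πⱼ ∉ Iᵢ` by the witness and `…ClValuation.not_mem_of_mul_sub_one_mem`);
* every prime above `2` is one of them (`…ClPrimesOver.exists_eq_span_pair_of_prod_eq` fed with `π₀π₁π₂ = 2H`);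
* hence the inputs `U = {w₀, w₁, w₂}`, `f ≡ 1` of the N5 valuation lemmas, and the EXACT-VALUATION wrapper
  `log_valuation_eq_of_splitCert` (non-membership at the two other primes + `v₂|N x| = e` ⇒ `ord_{wᵢ}(x) = e`).
Every check is a `Bool` on integers.  Sorry-free; axioms `propext`, `Classical.choice`, `Quot.sound`.
[cite: Marcus2018, Ch. 3, Thm. 22] [cite: Cohen1993, §4.8.2, §4.8.3]
-/

set_option linter.dupNamespace false

noncomputable section

open scoped Classical NumberField nonZeroDivisors

open Literature.NumberTheory.NumberFields Polynomial Module NumberField IsDedekindDomain Ideal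

namespace Summit.BirchSwinnertonDyer.BirchSwinnertonDyer.Rank2Observatory.TwoDescCl

open TwoDescCubic

variable {K : Type*} [Field K] [NumberField K] {a b c : ℤ} {θ : K}

/-- Certificate naming the three primes above a totally split `2` by elements. [cite: Cohen1993, §4.8.2] -/
structure SplitTwo where
  /-- the namers `π₀, π₁, π₂` -/
  pi : Fin 3 → FracElt
  /-- `|N(πᵢ)| = 2 · n i`, `n i` odd -/
  n : Fin 3 → ℕ
  /-- `π₀ · π₁` -/
  PP : FracElt
  /-- `π₀ π₁ π₂ = 2 · H` -/
  H : FracElt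
  /-- witnesses of `π_j − 1 = 2 · s i j + π_i · t i j` for `i ≠ j` -/
  s : Fin 3 → Fin 3 → FracElt
  t : Fin 3 → Fin 3 → FracElt

namespace SplitTwo

/-- The CHECK of a `SplitTwo` certificate (all on integers). [cite: Cohen1993, §4.8.2] -/
def check (a b c : ℤ) (D : SplitTwo) : Bool :=
  decide (∀ i : Fin 3, (D.pi i).check a b c = true) && (D.PP.check a b c && (D.H.check a b c &&
  (decide (∀ i j : Fin 3, i ≠ j → ((D.s i j).check a b c = true ∧ (D.t i j).check a b c = true)) &&
  (decide (∀ i : Fin 3, (normFormZ a b c (D.pi i).X.1 (D.pi i).X.2.1 (D.pi i).X.2.2).natAbs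
      = (D.pi i).m ^ 3 * (2 * D.n i) ∧ D.n i % 2 = 1) &&
  (FracElt.mulCheck a b c (D.pi 0) (D.pi 1) D.PP && (FracElt.mulEqZsmulCheck a b c D.PP (D.pi 2) 2 D.H &&
  decide (∀ i j : Fin 3, i ≠ j → FracElt.linCheck a b c 2 1 (D.pi j) (D.pi i) (D.s i j) (D.t i j) = true)))))))

section Sound

variable (hirr : Irreducible (MonicCubic.polyQ a b c)) (hθ : aeval θ (MonicCubic.poly a b c) = 0)
  (h3 : finrank ℚ K = 3) {D : SplitTwo} (hD : D.check a b c = true)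

/-- Unpacked check. [folklore] -/
theorem check_spec (hD : D.check a b c = true) :
    (∀ i : Fin 3, (D.pi i).check a b c = true) ∧ D.PP.check a b c = true ∧ D.H.check a b c = true ∧
    (∀ i j : Fin 3, i ≠ j → ((D.s i j).check a b c = true ∧ (D.t i j).check a b c = true)) ∧
    (∀ i : Fin 3, (normFormZ a b c (D.pi i).X.1 (D.pi i).X.2.1 (D.pi i).X.2.2).natAbs
      = (D.pi i).m ^ 3 * (2 * D.n i) ∧ D.n i % 2 = 1) ∧
    FracElt.mulCheck a b c (D.pi 0) (D.pi 1) D.PP = true ∧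
    FracElt.mulEqZsmulCheck a b c D.PP (D.pi 2) 2 D.H = true ∧
    (∀ i j : Fin 3, i ≠ j → FracElt.linCheck a b c 2 1 (D.pi j) (D.pi i) (D.s i j) (D.t i j) = true) := by
  simpa only [check, Bool.and_eq_true, decide_eq_true_eq] using hD

/-- The namer `πᵢ ∈ 𝓞 K`. [folklore] -/
def piInt (hθ : aeval θ (MonicCubic.poly a b c) = 0) (hD : D.check a b c = true) (i : Fin 3) : 𝓞 K :=
  (D.pi i).toInt hθ ((check_spec hD).1 i)

/-- The ideal `Iᵢ = (2, πᵢ)`. [folklore] -/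
def I (hθ : aeval θ (MonicCubic.poly a b c) = 0) (hD : D.check a b c = true) (i : Fin 3) : Ideal (𝓞 K) :=
  span {((2 : ℕ) : 𝓞 K), piInt hθ hD i}

include hirr h3 in
/-- `|N(πᵢ)| = 2 nᵢ`. [folklore] -/
theorem natAbs_norm_piInt (i : Fin 3) : (Algebra.norm ℤ (piInt hθ hD i)).natAbs = 2 * D.n i :=
  FracElt.natAbs_norm_toInt hirr hθ h3 _ _ ((check_spec hD).2.2.2.2.1 i).1

include h3 in
/-- `N(2) = 8` in `𝓞 K`. [folklore] -/
theorem natAbs_norm_two : (Algebra.norm ℤ ((2 : ℕ) : 𝓞 K)).natAbs = 8 := by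
  have h0 := Algebra.norm_algebraMap (S := 𝓞 K) (R := ℤ) ((2 : ℕ) : ℤ)
  rw [NumberField.RingOfIntegers.rank, h3, map_natCast] at h0
  rw [h0, Int.natAbs_pow, Int.natAbs_natCast]

/-- The product identity `π₀ π₁ π₂ = 2 H`. [folklore] -/
theorem prod_piInt_eq :
    piInt hθ hD 0 * piInt hθ hD 1 * piInt hθ hD 2 = ((2 : ℕ) : 𝓞 K) * D.H.toInt hθ (check_spec hD).2.2.1 := by
  have hs := check_spec hD
  have h01 := FracElt.toInt_mul_of_mulCheck hθ (hs.1 0) (hs.1 1) hs.2.1 hs.2.2.2.2.2.1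
  have h2 := FracElt.toInt_mul_eq_of_mulEqZsmulCheck hθ hs.2.1 (hs.1 2) hs.2.2.1 hs.2.2.2.2.2.2.1
  simp only [piInt]
  rw [h01, h2]; push_cast; ring

/-- `πⱼ − 1 ∈ Iᵢ` for `i ≠ j` (the distinctness / non-membership witness). [folklore] -/
theorem piInt_sub_one_mem {i j : Fin 3} (hij : i ≠ j) : piInt hθ hD j * 1 - 1 ∈ I hθ hD i := by
  have hs := check_spec hD
  rw [mul_one]
  have h := FracElt.sub_mem_span_pair_of_linCheck hθ (hs.1 j) (hs.1 i) (hs.2.2.2.1 i j hij).1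
    (hs.2.2.2.1 i j hij).2 (hs.2.2.2.2.2.2.2 i j hij)
  simpa only [piInt, I, Int.cast_one] using h

include hirr h3 in
/-- `2 ∤ πⱼ πₖ` (norms: `8 ∤ 4 nⱼ nₖ`). [folklore] -/
theorem not_two_dvd_mul (j k : Fin 3) (hdvd : ((2 : ℕ) : 𝓞 K) ∣ piInt hθ hD j * piInt hθ hD k) : False := by
  have hn := fun i => natAbs_norm_piInt hirr hθ h3 hD i
  have hodd := fun i => ((check_spec hD).2.2.2.2.1 i).2
  have hN := map_dvd (Algebra.norm ℤ) hdvd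
  rw [map_mul] at hN
  have hN' := Int.natAbs_dvd_natAbs.mpr hN
  rw [Int.natAbs_mul, natAbs_norm_two h3, hn j, hn k] at hN'
  have hj := hodd j
  have hk := hodd k
  have h2 : 2 ∣ D.n j * D.n k := by
    have e : 2 * D.n j * (2 * D.n k) = 4 * (D.n j * D.n k) := by ring
    rw [e] at hN'
    omega
  rcases (Nat.Prime.dvd_mul Nat.prime_two).mp h2 with h | h <;> omega

include hirr h3 in
/-- `Iᵢ` is a proper ideal: otherwise `2 ∣ πⱼ πₖ`. [cite: Marcus2018, Ch. 3, Thm. 22] -/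
theorem I_ne_top (i : Fin 3) : I hθ hD i ≠ ⊤ := by
  intro htop
  have h1 : (1 : 𝓞 K) ∈ I hθ hD i := by rw [htop]; exact Submodule.mem_top
  obtain ⟨u, v, huv⟩ := mem_span_pair.mp h1
  have hprod := prod_piInt_eq hθ hD
  have hi : i = 0 ∨ i = 1 ∨ i = 2 := by fin_cases i <;> simp
  rcases hi with rfl | rfl | rfl
  · exact not_two_dvd_mul hirr hθ h3 hD 1 2 ⟨u * (piInt hθ hD 1 * piInt hθ hD 2) + v * D.H.toInt hθ (check_spec hD).2.2.1,
      by linear_combination (-(piInt hθ hD 1 * piInt hθ hD 2)) * huv + v * hprod⟩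
  · exact not_two_dvd_mul hirr hθ h3 hD 0 2 ⟨u * (piInt hθ hD 0 * piInt hθ hD 2) + v * D.H.toInt hθ (check_spec hD).2.2.1,
      by linear_combination (-(piInt hθ hD 0 * piInt hθ hD 2)) * huv + v * hprod⟩
  · exact not_two_dvd_mul hirr hθ h3 hD 0 1 ⟨u * (piInt hθ hD 0 * piInt hθ hD 1) + v * D.H.toInt hθ (check_spec hD).2.2.1,
      by linear_combination (-(piInt hθ hD 0 * piInt hθ hD 1)) * huv + v * hprod⟩

include hirr h3 in
/-- `absNorm Iᵢ = 2`. [cite: Marcus2018, Ch. 3, Thm. 22] -/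
theorem absNorm_I (i : Fin 3) : absNorm (I hθ hD i) = 2 := by
  have hpi : piInt hθ hD i ∈ I hθ hD i := subset_span (by simp)
  have htwo : ((2 : ℕ) : 𝓞 K) ∈ I hθ hD i := subset_span (by simp)
  have d1 := Int.natAbs_dvd_natAbs.mpr (absNorm_dvd_norm_of_mem hpi)
  have d2 := Int.natAbs_dvd_natAbs.mpr (absNorm_dvd_norm_of_mem htwo)
  rw [Int.natAbs_natCast, natAbs_norm_piInt hirr hθ h3 hD i] at d1
  rw [Int.natAbs_natCast, natAbs_norm_two h3] at d2
  have hodd := ((check_spec hD).2.2.2.2.1 i).2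
  have hne : absNorm (I hθ hD i) ≠ 1 := fun h => I_ne_top hirr hθ h3 hD i (absNorm_eq_one_iff.mp h)
  -- `absNorm I ∣ 8`, `absNorm I ∣ 2 n` with `n` odd, `absNorm I ≠ 1`
  obtain ⟨k, hk, hk'⟩ := (Nat.dvd_prime_pow Nat.prime_two).mp (show absNorm (I hθ hD i) ∣ 2 ^ 3 by simpa using d2)
  rw [hk'] at d1 hne ⊢
  interval_cases k
  · simp at hne
  · norm_num
  · exfalso
    have : 4 ∣ 2 * D.n i := by simpa using d1
    omega
  · exfalso
    have : 8 ∣ 2 * D.n i := by simpa using d1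
    omega

include hirr h3 in
/-- `Iᵢ` is prime. [cite: Marcus2018, Ch. 3, Thm. 22] -/
theorem I_isPrime (i : Fin 3) : (I hθ hD i).IsPrime :=
  isPrime_of_irreducible_absNorm (by rw [absNorm_I hirr hθ h3 hD i]; exact (Nat.prime_iff.mp Nat.prime_two).irreducible)

/-- `Iᵢ ≠ ⊥` (it contains `2`). [folklore] -/
theorem I_ne_bot (i : Fin 3) : I hθ hD i ≠ ⊥ := by
  intro h
  have htwo : ((2 : ℕ) : 𝓞 K) ∈ I hθ hD i := subset_span (by simp)
  rw [h, Submodule.mem_bot] at htwo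
  exact two_ne_zero (by exact_mod_cast htwo)

/-- **The named prime `wᵢ`** above `2`. [cite: Marcus2018, Ch. 3, Thm. 22] -/
def w (i : Fin 3) : HeightOneSpectrum (𝓞 K) :=
  ⟨I hθ hD i, I_isPrime hirr hθ h3 hD i, I_ne_bot hθ hD i⟩

/-- `wᵢ.asIdeal = (2, πᵢ)`. [folklore] -/
@[simp] theorem w_asIdeal (i : Fin 3) : (w hirr hθ h3 hD i).asIdeal = I hθ hD i := rfl

include hirr h3 in
/-- `Iᵢ` is maximal. [folklore] -/
theorem I_isMaximal (i : Fin 3) : (I hθ hD i).IsMaximal :=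
  (I_isPrime hirr hθ h3 hD i).isMaximal (I_ne_bot hθ hD i)

/-- `πᵢ ∈ wᵢ`. [folklore] -/
theorem piInt_mem_w (i : Fin 3) : piInt hθ hD i ∈ (w hirr hθ h3 hD i).asIdeal := subset_span (by simp [piInt])

/-- `πⱼ ∉ wᵢ` for `i ≠ j`. [folklore] -/
theorem piInt_not_mem_w {i j : Fin 3} (hij : i ≠ j) : piInt hθ hD j ∉ (w hirr hθ h3 hD i).asIdeal :=
  not_mem_of_mul_sub_one_mem _ (piInt_sub_one_mem hθ hD hij)

/-- **Pairwise distinct.** [cite: Marcus2018, Ch. 3, Thm. 22] -/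
theorem w_injective : Function.Injective (w hirr hθ h3 hD) := by
  intro i j hij
  by_contra hne
  have hj : piInt hθ hD j ∈ (w hirr hθ h3 hD j).asIdeal := piInt_mem_w hirr hθ h3 hD j
  rw [← hij] at hj
  exact piInt_not_mem_w hirr hθ h3 hD hne hj

/-- **Cover**: every prime above `2` is one of `w₀, w₁, w₂`. [cite: Marcus2018, Ch. 3, Thm. 22] -/
theorem eq_w_of_two_mem (u : HeightOneSpectrum (𝓞 K)) (hu : ((2 : ℕ) : 𝓞 K) ∈ u.asIdeal) :
    ∃ i, u = w hirr hθ h3 hD i := by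
  have hprod : ∏ i, piInt hθ hD i ^ (fun _ => 1) i = ((2 : ℕ) : 𝓞 K) * D.H.toInt hθ (check_spec hD).2.2.1 := by
    rw [Fin.prod_univ_three]; simp only [pow_one]; exact prod_piInt_eq hθ hD
  obtain ⟨i, hi⟩ := exists_eq_span_pair_of_prod_eq 2 (piInt hθ hD) (fun _ => 1) _ hprod
    (I_isMaximal hirr hθ h3 hD) u.asIdeal u.isPrime hu
  exact ⟨i, HeightOneSpectrum.ext hi⟩

/-- The set `U = {w₀, w₁, w₂}` of primes above `2`. [folklore] -/
def U : Finset (HeightOneSpectrum (𝓞 K)) := Finset.univ.image (w hirr hθ h3 hD)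

/-- `U` contains every prime above `2` (input `hU` of the N5 lemmas). [folklore] -/
theorem mem_U_of_two_mem (u : HeightOneSpectrum (𝓞 K)) (hu : ((2 : ℕ) : 𝓞 K) ∈ u.asIdeal) :
    u ∈ U hirr hθ h3 hD := by
  obtain ⟨i, rfl⟩ := eq_w_of_two_mem hirr hθ h3 hD u hu
  exact Finset.mem_image.mpr ⟨i, Finset.mem_univ _, rfl⟩

/-- Members of `U` are the `wᵢ`. [folklore] -/
theorem exists_eq_w_of_mem_U {u : HeightOneSpectrum (𝓞 K)} (hu : u ∈ U hirr hθ h3 hD) :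
    ∃ i, u = w hirr hθ h3 hD i := by
  obtain ⟨i, -, rfl⟩ := Finset.mem_image.mp hu; exact ⟨i, rfl⟩

/-- Every member of `U` has residue degree one: `absNorm = 2 ^ 1` (input `hf` of the N5 lemmas, `f ≡ 1`). [folklore] -/
theorem absNorm_of_mem_U (u : HeightOneSpectrum (𝓞 K)) (hu : u ∈ U hirr hθ h3 hD) :
    absNorm u.asIdeal = 2 ^ (fun _ : HeightOneSpectrum (𝓞 K) => 1) u := by
  obtain ⟨i, rfl⟩ := exists_eq_w_of_mem_U hirr hθ h3 hD hu
  simpa using absNorm_I hirr hθ h3 hD i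

/-- `wᵢ ∈ U`. [folklore] -/
theorem w_mem_U (i : Fin 3) : w hirr hθ h3 hD i ∈ U hirr hθ h3 hD :=
  Finset.mem_image.mpr ⟨i, Finset.mem_univ _, rfl⟩

/-- **EXACT VALUATION from a split certificate** (single-prime squeeze at `wᵢ`): if `x ∉ wⱼ` for both `j ≠ i`
and `|N(x)| = 2^e · m` with `m` odd, then `ord_{wᵢ}(x) = e`. [cite: Cohen1993, §4.8.3] -/
theorem log_valuation_eq_of_not_mem (i : Fin 3) {x : 𝓞 K}
    (hothers : ∀ j, j ≠ i → x ∉ (w hirr hθ h3 hD j).asIdeal) {e m : ℕ}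
    (hN : (Algebra.norm ℤ x).natAbs = 2 ^ e * m) (hm : ¬ 2 ∣ m) :
    WithZero.log ((w hirr hθ h3 hD i).valuation K (x : K)) = -(e : ℤ) := by
  refine log_valuation_eq_of_forall_not_mem Nat.prime_two (U hirr hθ h3 hD) (mem_U_of_two_mem hirr hθ h3 hD)
    (fun _ => 1) (absNorm_of_mem_U hirr hθ h3 hD) (w_mem_U hirr hθ h3 hD i) Nat.one_pos ?_ (by simpa using hN) hm
  intro u hu hne
  obtain ⟨j, rfl⟩ := exists_eq_w_of_mem_U hirr hθ h3 hD hu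
  exact hothers j (fun h => hne (by rw [h]))

/-- Non-membership `x ∉ wⱼ` from a witness `x − 1 = 2 s + πⱼ t` (`FracElt.linCheck … 2 1 x πⱼ s t`). [folklore] -/
theorem not_mem_w_of_linCheck (j : Fin 3) {x s t : FracElt} (cx : x.check a b c = true)
    (cs : s.check a b c = true) (ct : t.check a b c = true)
    (h : FracElt.linCheck a b c 2 1 x (D.pi j) s t = true) :
    x.toInt hθ cx ∉ (w hirr hθ h3 hD j).asIdeal := by
  apply not_mem_of_mul_sub_one_mem _ (y := 1)
  rw [mul_one]
  have hm := FracElt.sub_mem_span_pair_of_linCheck hθ cx ((check_spec hD).1 j) cs ct h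
  simpa only [w_asIdeal, I, piInt, Int.cast_one] using hm

/-- Membership `x ∈ wⱼ` from a witness `x = 2 s + πⱼ t` (`FracElt.linCheck … 2 0 x πⱼ s t`). [folklore] -/
theorem mem_w_of_linCheck (j : Fin 3) {x s t : FracElt} (cx : x.check a b c = true)
    (cs : s.check a b c = true) (ct : t.check a b c = true)
    (h : FracElt.linCheck a b c 2 0 x (D.pi j) s t = true) :
    x.toInt hθ cx ∈ (w hirr hθ h3 hD j).asIdeal := by
  have hm := FracElt.sub_mem_span_pair_of_linCheck hθ cx ((check_spec hD).1 j) cs ct h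
  simpa only [w_asIdeal, I, piInt, Int.cast_zero, sub_zero] using hm

/-- `ord_{wⱼ}(x) = 0` (`log v = 0`) from a non-membership witness. [folklore] -/
theorem log_valuation_eq_zero_of_linCheck (j : Fin 3) {x s t : FracElt} (cx : x.check a b c = true)
    (cs : s.check a b c = true) (ct : t.check a b c = true)
    (h : FracElt.linCheck a b c 2 1 x (D.pi j) s t = true) :
    WithZero.log ((w hirr hθ h3 hD j).valuation K ((x.toInt hθ cx : 𝓞 K) : K)) = 0 := by
  have h1 : (w hirr hθ h3 hD j).valuation K ((x.toInt hθ cx : 𝓞 K) : K) = 1 := by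
    rw [RingOfIntegers.coe_eq_algebraMap]
    exact (HeightOneSpectrum.valuation_eq_one_iff_notMem (v := w hirr hθ h3 hD j) (K := K)).mpr
      (not_mem_w_of_linCheck hirr hθ h3 hD j cx cs ct h)
  rw [h1, WithZero.log_one]

/-! ## Class certificates at the named primes (sweep input at `p = 2`) -/

/-- CLASS CERTIFICATE at `wᵢ` relative to the auxiliary prime `q`: `γ = 2·s + πᵢ·t` and `|N(γ)| = 2 · q ^ j`
(so `(γ) = wᵢ · J` with `N(J) = q^j`, and `[wᵢ] ∈ H_q`). [cite: Marcus2018, Ch. 5, Thm. 35] -/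
structure ClassCertS where
  γ : FracElt
  s : FracElt
  t : FracElt
  j : ℕ

/-- Check of a class certificate against the namer `πᵢ`. [cite: Cohen1993, §6.5 (relations)] -/
def ClassCertS.check (a b c : ℤ) (q : ℕ) (pi : FracElt) (C : ClassCertS) : Bool :=
  C.γ.check a b c && (C.s.check a b c && (C.t.check a b c && (FracElt.linCheck a b c 2 0 C.γ pi C.s C.t &&
    decide ((normFormZ a b c C.γ.X.1 C.γ.X.2.1 C.γ.X.2.2).natAbs = C.γ.m ^ 3 * (2 * q ^ C.j)))))

/-- **`[wᵢ] ∈ H_q`** from a class certificate. [cite: Marcus2018, Ch. 5, Thm. 35] -/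
theorem classIn_w_of_classCert {q : ℕ} (hq : q.Prime) (i : Fin 3) {C : ClassCertS}
    (hC : C.check a b c q (D.pi i) = true) :
    ClassIn (Subgroup.closure {cc : ClassGroup (𝓞 K) | ∃ (J : Ideal (𝓞 K))
      (hJ : J ∈ (Ideal (𝓞 K))⁰), ((q : ℕ) : 𝓞 K) ∈ J ∧ ClassGroup.mk0 ⟨J, hJ⟩ = cc}) (w hirr hθ h3 hD i).asIdeal := by
  simp only [ClassCertS.check, Bool.and_eq_true, decide_eq_true_eq] at hC
  obtain ⟨cγ, cs, ct, hlin, hN⟩ := hC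
  have hrel := FracElt.toInt_eq_of_linCheck hθ cγ ((check_spec hD).1 i) cs ct hlin
  rw [Int.cast_zero, sub_zero] at hrel
  have hnorm := FracElt.natAbs_norm_toInt hirr hθ h3 C.γ cγ hN
  rw [w_asIdeal]
  change ClassIn _ (span {((2 : ℕ) : 𝓞 K), piInt hθ hD i})
  refine classIn_tsupp_span_pair_of_rel hq (p := 2) (g := piInt hθ hD i) (I_ne_bot hθ hD i) (f := 1)
    (by rw [pow_one]; exact absNorm_I hirr hθ h3 hD i) (C.s.toInt hθ cs) (C.t.toInt hθ ct) (C.γ.toInt hθ cγ) ?_ C.j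
    (by rw [hnorm, pow_one])
  change C.s.toInt hθ cs * ((2 : ℕ) : 𝓞 K) + C.t.toInt hθ ct * (D.pi i).toInt hθ ((check_spec hD).1 i)
    = C.γ.toInt hθ cγ
  rw [hrel]; ring

include hirr hθ h3 hD in
/-- **Every prime above `2` lies in `H_q`**, given class certificates at the three named primes —
the `p = 2` case of the class-group sweep. [cite: Marcus2018, Ch. 5, Cor. 2 to Thm. 35] -/
theorem classIn_of_two_mem {q : ℕ} (hq : q.Prime) (C : Fin 3 → ClassCertS)
    (hC : ∀ i, (C i).check a b c q (D.pi i) = true) (P : Ideal (𝓞 K)) (hP : P.IsPrime)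
    (h2 : ((2 : ℕ) : 𝓞 K) ∈ P) :
    ClassIn (Subgroup.closure {cc : ClassGroup (𝓞 K) | ∃ (J : Ideal (𝓞 K))
      (hJ : J ∈ (Ideal (𝓞 K))⁰), ((q : ℕ) : 𝓞 K) ∈ J ∧ ClassGroup.mk0 ⟨J, hJ⟩ = cc}) P := by
  have hP0 : P ≠ ⊥ := by
    intro h; rw [h, Submodule.mem_bot] at h2; exact two_ne_zero (by exact_mod_cast h2)
  obtain ⟨i, hi⟩ := eq_w_of_two_mem hirr hθ h3 hD ⟨P, hP, hP0⟩ h2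
  have hP' : P = (w hirr hθ h3 hD i).asIdeal := by rw [← hi]
  rw [hP']
  exact classIn_w_of_classCert hirr hθ h3 hD hq i (hC i)

end Sound

end SplitTwo

end Summit.BirchSwinnertonDyer.BirchSwinnertonDyer.Rank2Observatory.TwoDescCl
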